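import Summits.CriticalPhenomena.SAWScalingLimit.Theorems.SAWTotalPositivityCriticalBubbleBoundJoinSurgeryDefs
import Summits.CriticalPhenomena.SAWScalingLimit.Theorems.SAWTotalPositivityCriticalBubbleBoundJoinReplace
import Summits.CriticalPhenomena.SAWScalingLimit.Theorems.SAWTotalPositivityCriticalBubbleBoundDockingEntropyZero

/-!
# Madras' modification, cases `B2b` and `C2b` (stubs `modify_spec_B2b`, `modify_spec_C2b` of line
`docking-census-joining`, crux stmt-CriticalPhenomena-7117
`Summit.CriticalPhenomena.SAWScalingLimit.Theses.SAWTotalPositivity.CriticalBubbleBound`)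

The two "dropped corner" cases of the modification `modify E Y` (`…JoinSurgeryDefs.lean`) of a
polygon `E` of `ℤ²` at its window `Y`, the right corridor `{Y + (s, t) : s ≥ 1, |t| ≤ 1}` being
vertex-free.  Case `B2b`: `Y` is not a vertex, `q = Y + (0, 1)` is, and `c' = Y + (1, 2)` is a
vertex whose right edge is absent.  A vertex of a polygon has two distinct polygon-neighbours among
its four lattice neighbours (`corner_edges`); for `q` the right one is a corridor site and the lower
one is `Y`, so `q` has the edges left and up and `c = Y + (0, 2)` is a vertex with `s(q, c) ∈ E`; for
`c'` the right edge is absent and the lower neighbour is a corridor site, so `s(c, c') ∈ E`.  The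
sub-path `q – c – c'` is replaced (`isPolygon_replace_two`, `…JoinReplace.lean`) by the ten-edge
path `(0,1) (0,0) (1,0) (1,-1) (2,-1) (3,-1) (3,0) (3,1) (2,1) (1,1) (1,2)` (relative to `Y`)
through `Y` and the corridor; `c` is dropped.  Case `C2b` is the mirror image in the row of `Y`.
Both are instances of one private statement `surgery` on an explicit chain of relative sites (side
conditions by `decide`; no new definitions).  [folklore] bookkeeping for Hammond, Ann. Probab. 46
(2018) §4.1.
-/

noncomputable section

open SimpleGraph
open Literature.Probability.LatticeModels
open Literature.Probability.RandomPlanarGeometry Literature.Probability.RandomPlanarGeometry.SAW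
open scoped BigOperators
open Summit.CriticalPhenomena.SAWScalingLimit.Theorems.CriticalBubbleBound.Negative (e₀)
open Summit.CriticalPhenomena.SAWScalingLimit.Theorems.CriticalBubbleBound.Docking

namespace Summit.CriticalPhenomena.SAWScalingLimit.Theorems.CriticalBubbleBound.Join

/-! ## Sites relative to the window -/

/-- Two sites of `ℤ²` with equal coordinates are equal. [folklore] -/
private theorem site_eq {x y : Site 2} (h0 : x 0 = y 0) (h1 : x 1 = y 1) : x = y :=
  funext (Fin.forall_fin_two.2 ⟨h0, h1⟩)

/-- Coordinates of `pt Y (a, b) = Y + (a, b)`. [folklore] -/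
private theorem pt_mk_apply (Y : Site 2) (a b : ℤ) :
    pt Y (a, b) 0 = Y 0 + a ∧ pt Y (a, b) 1 = Y 1 + b := by
  simp [pt]

/-- `pt Y` is injective. [folklore] -/
private theorem pt_injective (Y : Site 2) : Function.Injective (pt Y) := by
  rintro ⟨a, b⟩ ⟨a', b'⟩ h
  obtain ⟨h0, h1⟩ := pt_mk_apply Y a b
  obtain ⟨h0', h1'⟩ := pt_mk_apply Y a' b'
  rw [h] at h0 h1
  rw [Prod.mk.injEq]; exact ⟨by omega, by omega⟩

/-- `pt Y (a, b) + e₀ = pt Y (a + 1, b)`. [folklore] -/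
private theorem pt_add_e₀ (Y : Site 2) (a b : ℤ) : pt Y (a, b) + e₀ = pt Y (a + 1, b) := by
  obtain ⟨h0, h1⟩ := pt_mk_apply Y a b
  obtain ⟨h0', h1'⟩ := pt_mk_apply Y (a + 1) b
  obtain ⟨k0, k1, -, -⟩ := e₀_e₁_apply
  exact site_eq (by rw [Pi.add_apply]; omega) (by rw [Pi.add_apply]; omega)

/-- `pt Y (a, b) + e₁ = pt Y (a, b + 1)`. [folklore] -/
private theorem pt_add_e₁ (Y : Site 2) (a b : ℤ) : pt Y (a, b) + e₁ = pt Y (a, b + 1) := by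
  obtain ⟨h0, h1⟩ := pt_mk_apply Y a b
  obtain ⟨h0', h1'⟩ := pt_mk_apply Y a (b + 1)
  obtain ⟨-, -, k0, k1⟩ := e₀_e₁_apply
  exact site_eq (by rw [Pi.add_apply]; omega) (by rw [Pi.add_apply]; omega)

/-- `pt Y (a, b) - e₀ = pt Y (a - 1, b)`. [folklore] -/
private theorem pt_sub_e₀ (Y : Site 2) (a b : ℤ) : pt Y (a, b) - e₀ = pt Y (a - 1, b) := by
  rw [sub_eq_iff_eq_add, pt_add_e₀, sub_add_cancel]

/-- `pt Y (a, b) - e₁ = pt Y (a, b - 1)`. [folklore] -/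
private theorem pt_sub_e₁ (Y : Site 2) (a b : ℤ) : pt Y (a, b) - e₁ = pt Y (a, b - 1) := by
  rw [sub_eq_iff_eq_add, pt_add_e₁, sub_add_cancel]

/-- `pt Y (0, 0) = Y`. [folklore] -/
private theorem pt_zero (Y : Site 2) : pt Y (0, 0) = Y := by
  obtain ⟨h0, h1⟩ := pt_mk_apply Y 0 0
  exact site_eq (by omega) (by omega)

/-- `Y + e₁ = pt Y (0, 1)`. [folklore] -/
private theorem add_e₁_eq (Y : Site 2) : Y + e₁ = pt Y (0, 1) := by
  have h := pt_add_e₁ Y 0 0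
  rwa [pt_zero, zero_add] at h

/-- `Y - e₁ = pt Y (0, -1)`. [folklore] -/
private theorem sub_e₁_eq (Y : Site 2) : Y - e₁ = pt Y (0, -1) := by
  have h := pt_sub_e₁ Y 0 0
  rwa [pt_zero, zero_sub] at h

/-! ## Local structure of a polygon of `ℤ²` at a vertex -/

/-- An edge of a polygon of `ℤ²` is a lattice edge. [folklore] -/
private theorem adj_of_mem {E : Finset (Sym2 (Site 2))} (hE : IsPolygon (zdGraph 2) E)
    {a b : Site 2} (h : s(a, b) ∈ E) : (zdGraph 2).Adj a b := by
  obtain ⟨u, c, -, rfl⟩ := hE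
  exact c.adj_of_mem_edges (List.mem_toFinset.1 h)

/-- A vertex of a polygon (the edge set of a cycle) has two distinct polygon-neighbours. [folklore] -/
private theorem exists_two_nbrs {E : Finset (Sym2 (Site 2))} (hE : IsPolygon (zdGraph 2) E)
    {v : Site 2} (hv : IsV E v) : ∃ x x' : Site 2, x ≠ x' ∧ s(v, x) ∈ E ∧ s(v, x') ∈ E := by
  obtain ⟨u, c, hc, rfl⟩ := hE
  obtain ⟨e, he, hve⟩ := hv
  have hvs : v ∈ c.support :=
    (Walk.mem_support_iff_exists_mem_edges_of_not_nil hc.not_nil).2 ⟨e, List.mem_toFinset.1 he, hve⟩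
  obtain ⟨x, x', hne, hN⟩ := Set.ncard_eq_two.1 (hc.ncard_neighborSet_toSubgraph_eq_two hvs)
  have hx : ∀ w, w ∈ ({x, x'} : Set (Site 2)) → s(v, w) ∈ c.edges.toFinset := by
    intro w hw
    rw [← hN, Subgraph.mem_neighborSet, Walk.adj_toSubgraph_iff_mem_edges] at hw
    exact List.mem_toFinset.2 hw
  exact ⟨x, x', hne, hx x (Set.mem_insert _ _), hx x' (Set.mem_insert_of_mem _ rfl)⟩

/-- If `w` is not a vertex of `E`, no edge `vw` lies in `E`. [folklore] -/
private theorem notMem_of_not_isV {E : Finset (Sym2 (Site 2))} {v w : Site 2} (h : ¬ IsV E w) :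
    s(v, w) ∉ E := fun he => h ⟨_, he, Sym2.mem_mk_right v w⟩

/-- CORNER RULE. A vertex `pt Y (a, b)` of a polygon of `ℤ²` whose right edge and whose vertical
edge towards row `b - σ` (`σ = ±1`) are absent has its left edge and the other vertical edge. [folklore] -/
private theorem corner_edges {E : Finset (Sym2 (Site 2))} (hE : IsPolygon (zdGraph 2) E)
    (Y : Site 2) (a b σ : ℤ) (hσ : σ = 1 ∨ σ = -1) (hv : IsV E (pt Y (a, b)))
    (hr : s(pt Y (a, b), pt Y (a + 1, b)) ∉ E) (hd : s(pt Y (a, b), pt Y (a, b - σ)) ∉ E) :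
    s(pt Y (a, b), pt Y (a - 1, b)) ∈ E ∧ s(pt Y (a, b), pt Y (a, b + σ)) ∈ E := by
  obtain ⟨x, x', hne, hx, hx'⟩ := exists_two_nbrs hE hv
  have key : ∀ w, s(pt Y (a, b), w) ∈ E → w = pt Y (a - 1, b) ∨ w = pt Y (a, b + σ) := by
    intro w hw
    rcases adj_cases (adj_of_mem hE hw) with rfl | rfl | rfl | rfl
    · rw [pt_add_e₀] at hw; exact absurd hw hr
    · exact Or.inl (pt_sub_e₀ Y a b)
    · rw [pt_add_e₁] at hw ⊢
      rcases hσ with rfl | rfl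
      · exact Or.inr rfl
      · rw [sub_neg_eq_add] at hd; exact absurd hw hd
    · rw [pt_sub_e₁] at hw ⊢
      rcases hσ with rfl | rfl
      · exact absurd hw hd
      · exact Or.inr (by rw [← sub_eq_add_neg])
  rcases key x hx with rfl | rfl <;> rcases key x' hx' with rfl | rfl
  · exact absurd rfl hne
  · exact ⟨hx, hx'⟩
  · exact ⟨hx', hx⟩
  · exact absurd rfl hne

/-! ## Lattice walks along explicit lists of relative sites -/

/-- A unit step of relative sites (`ℓ¹`-distance one) is a lattice edge. [folklore] -/
private theorem adj_of_step (Y : Site 2) {u v : ℤ × ℤ}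
    (h : max (v.1 - u.1) (u.1 - v.1) + max (v.2 - u.2) (u.2 - v.2) = 1) :
    (zdGraph 2).Adj (pt Y u) (pt Y v) := by
  obtain ⟨a, b⟩ := u
  obtain ⟨a', b'⟩ := v
  dsimp only at h
  rcases (by omega : (a' = a + 1 ∧ b' = b) ∨ (a = a' + 1 ∧ b' = b) ∨ (a' = a ∧ b' = b + 1) ∨
    (a' = a ∧ b = b' + 1)) with ⟨rfl, rfl⟩ | ⟨rfl, rfl⟩ | ⟨rfl, rfl⟩ | ⟨rfl, rfl⟩
  · rw [← pt_add_e₀]; exact adj_add_e₀ _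
  · rw [← pt_add_e₀]; exact (adj_add_e₀ _).symm
  · rw [← pt_add_e₁]; exact adj_add_e₁ _
  · rw [← pt_add_e₁]; exact (adj_add_e₁ _).symm

/-- A chain `p :: l` of unit steps ending at `q` is traced by a lattice walk from `pt Y p` to
`pt Y q` with the expected vertices, edges and length. [folklore] -/
private theorem exists_walk (Y : Site 2) (q : ℤ × ℤ) : ∀ (l : List (ℤ × ℤ)) (p : ℤ × ℤ),
    (p :: l).IsChain (fun u v : ℤ × ℤ =>
      max (v.1 - u.1) (u.1 - v.1) + max (v.2 - u.2) (u.2 - v.2) = 1) →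
    (p :: l).getLast (List.cons_ne_nil p l) = q →
    ∃ W : (zdGraph 2).Walk (pt Y p) (pt Y q), W.support = (p :: l).map (pt Y) ∧
      W.edges = ((p :: l).zip l).map (fun x => s(pt Y x.1, pt Y x.2)) ∧ W.length = l.length
  | [], p, _, hq => by
    obtain rfl : p = q := hq
    exact ⟨Walk.nil, rfl, rfl, rfl⟩
  | r :: l, p, hc, hq => by
    rw [List.isChain_cons_cons] at hc
    obtain ⟨W, hs, he, hl⟩ := exists_walk Y q l r hc.2 hq
    exact ⟨Walk.cons (adj_of_step Y hc.1) W, by rw [Walk.support_cons, hs]; rfl,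
      by rw [Walk.edges_cons, he]; rfl, by rw [Walk.length_cons, hl]; rfl⟩

/-! ## Generic two-edge surgery at the window -/

/-- GENERIC TWO-EDGE SURGERY. `E` a polygon of `ℤ²`, `Y` a non-vertex with vertex-free right
corridor, `pt Y p – pt Y m – pt Y q` two consecutive edges of `E`, `p :: l` a self-avoiding chain of
`≥ 2` unit steps from `p` to `q` whose other sites lie in `l.dropLast` and are fresh (`Y` or corridor
sites), every step with an endpoint in `l.dropLast`, all in columns `≤ 3`: then
`S = (E ∖ {pm, mq}) ∪ A` (`A` the steps) is a polygon with `#E + |l| - 2` edges, with the window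
bound, vertex bookkeeping, survival, inverse, and `A ⊆ S`. [folklore] -/
private theorem surgery {E : Finset (Sym2 (Site 2))} (hE : IsPolygon (zdGraph 2) E) (Y : Site 2)
    {p m q : ℤ × ℤ} {l : List (ℤ × ℤ)} (hch : (p :: l).IsChain fun u v : ℤ × ℤ =>
      max (v.1 - u.1) (u.1 - v.1) + max (v.2 - u.2) (u.2 - v.2) = 1)
    (hlast : (p :: l).getLast (List.cons_ne_nil p l) = q) (hnd : (p :: l).Nodup)
    (hl : 2 ≤ l.length) (hpq : p ≠ q) (hint : ∀ d ∈ p :: l, d = p ∨ d = q ∨ d ∈ l.dropLast)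
    (hfr : ∀ d ∈ l.dropLast, d = (0, 0) ∨ (1 ≤ d.1 ∧ -1 ≤ d.2 ∧ d.2 ≤ 1))
    (hfe : ∀ x ∈ (p :: l).zip l, x.1 ∈ l.dropLast ∨ x.2 ∈ l.dropLast) (hd3 : ∀ d ∈ p :: l, d.1 ≤ 3)
    (hY : ¬ IsV E Y) (hcorr : ∀ s t : ℤ, 1 ≤ s → -1 ≤ t → t ≤ 1 → ¬ IsV E (Y + ![s, t]))
    (h1 : s(pt Y p, pt Y m) ∈ E) (h2 : s(pt Y m, pt Y q) ∈ E) (A S : Finset (Sym2 (Site 2)))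
    (hA : A = (((p :: l).zip l).map fun x => s(pt Y x.1, pt Y x.2)).toFinset)
    (hS : S = E \ {s(pt Y p, pt Y m), s(pt Y m, pt Y q)} ∪ A) :
    IsPolygon (zdGraph 2) S ∧ S.card + 2 = E.card + l.length ∧
      (∀ x, IsV S x → -1 ≤ x 1 - Y 1 → x 1 - Y 1 ≤ 1 → x 0 ≤ Y 0 + 3) ∧
      (∀ x, IsV S x → IsV E x ∨ x ∈ (l.dropLast.map (pt Y)).toFinset) ∧
      (∀ x, IsV E x → x ≠ pt Y m → IsV S x) ∧
      S \ A ∪ {s(pt Y p, pt Y m), s(pt Y m, pt Y q)} = E ∧ A ⊆ S := by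
  -- fresh relative sites are not vertices of `E`
  have hfresh : ∀ d ∈ l.dropLast, ¬ IsV E (pt Y d) := by
    intro d hd
    rcases hfr d hd with rfl | ⟨hd1, hd2, hd3'⟩
    · rw [pt_zero]; exact hY
    · exact hcorr d.1 d.2 hd1 hd2 hd3'
  -- the added path as a lattice walk `W`
  obtain ⟨W, hWs, hWe, hWl⟩ := exists_walk Y q l p hch hlast
  have hWA : W.edges.toFinset = A := by rw [hWe, hA]
  have hWnil : ¬ W.Nil := by rw [Walk.not_nil_iff_lt_length]; omega
  have hWp : W.IsPath := by
    rw [Walk.isPath_def, hWs]; exact List.Nodup.map (pt_injective Y) hnd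
  have hWi : ∀ x ∈ W.support, x ≠ pt Y p → x ≠ pt Y q → ¬ ∃ e ∈ E, x ∈ e := by
    intro x hx hxp hxq
    rw [hWs, List.mem_map] at hx
    obtain ⟨d, hd, rfl⟩ := hx
    rcases hint d hd with rfl | rfl | hdl
    · exact absurd rfl hxp
    · exact absurd rfl hxq
    · exact hfresh d hdl
  -- the replacement
  have hrep := isPolygon_replace_two E (pt Y p) (pt Y m) (pt Y q) W hE h1 h2
    (fun h' => hpq (pt_injective Y h')) hWp (by rw [hWl]; exact hl) hWi
  have hS' : (E.erase s(pt Y p, pt Y m)).erase s(pt Y m, pt Y q) ∪ W.edges.toFinset = S := by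
    rw [hS, hWA, Finset.sdiff_insert, Finset.sdiff_singleton_eq_erase, Finset.erase_right_comm]
  rw [hS', hWl] at hrep
  -- the vertices of the added edges are the path sites
  have hAv : ∀ x, IsV A x ↔ x ∈ (p :: l).map (pt Y) := fun x => by
    rw [← hWs, Walk.mem_support_iff_exists_mem_edges_of_not_nil hWnil, ← hWA]
    simp only [IsV, List.mem_toFinset]
  have hAS : A ⊆ S := by rw [hS]; exact Finset.subset_union_right
  have hSv : ∀ x, IsV S x → IsV E x ∨ ∃ d ∈ p :: l, pt Y d = x := by
    rintro x ⟨e, he, hx⟩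
    rw [hS, Finset.mem_union, Finset.mem_sdiff] at he
    rcases he with ⟨heE, -⟩ | heA
    · exact Or.inl ⟨e, heE, hx⟩
    · exact Or.inr (List.mem_map.1 ((hAv x).1 ⟨e, heA, hx⟩))
  have hvS : ∀ d ∈ p :: l, IsV S (pt Y d) := by
    intro d hd
    obtain ⟨e, he, hx⟩ := (hAv _).2 (List.mem_map.2 ⟨d, hd, rfl⟩)
    exact ⟨e, hAS he, hx⟩
  refine ⟨hrep.1, hrep.2, ?_, ?_, ?_, ?_, hAS⟩
  · -- the three window rows: abscissa at most `Y 0 + 3`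
    intro x hx hlo hhi
    rcases hSv x hx with hxE | ⟨⟨a, b⟩, hd, rfl⟩
    · by_contra hgt
      have hxe : Y + ![x 0 - Y 0, x 1 - Y 1] = x := site_eq (by simp) (by simp)
      refine hcorr (x 0 - Y 0) (x 1 - Y 1) (by omega) hlo hhi ?_
      rwa [hxe]
    · have h3 : a ≤ 3 := hd3 (a, b) hd
      rw [(pt_mk_apply Y a b).1]
      omega
  · -- vertices: old ones, or fresh cells
    intro x hx
    rcases hSv x hx with hxE | ⟨d, hd, rfl⟩
    · exact Or.inl hxE
    · rcases hint d hd with rfl | rfl | hdl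
      · exact Or.inl ⟨_, h1, Sym2.mem_mk_left _ _⟩
      · exact Or.inl ⟨_, h2, Sym2.mem_mk_right _ _⟩
      · exact Or.inr (List.mem_toFinset.2 (List.mem_map.2 ⟨d, hdl, rfl⟩))
  · -- survival of the old vertices other than the dropped one
    rintro x ⟨e, he, hx⟩ hxm
    by_cases heR : e ∈ ({s(pt Y p, pt Y m), s(pt Y m, pt Y q)} : Finset (Sym2 (Site 2)))
    · rw [Finset.mem_insert, Finset.mem_singleton] at heR
      rcases heR with rfl | rfl
      · rcases Sym2.mem_iff.1 hx with rfl | rfl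
        · exact hvS p List.mem_cons_self
        · exact absurd rfl hxm
      · rcases Sym2.mem_iff.1 hx with rfl | rfl
        · exact absurd rfl hxm
        · refine hvS q ?_
          rw [← List.mem_map_of_injective (pt_injective Y), ← hWs]
          exact W.end_mem_support
    · rw [hS]
      exact ⟨e, Finset.mem_union_left _ (Finset.mem_sdiff.2 ⟨he, heR⟩), hx⟩
  · -- undoing the surgery
    have hAE : Disjoint (E \ {s(pt Y p, pt Y m), s(pt Y m, pt Y q)}) A := by
      rw [Finset.disjoint_left]
      rintro e he heA
      rw [Finset.mem_sdiff] at he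
      rw [hA, List.mem_toFinset, List.mem_map] at heA
      obtain ⟨x, hx, rfl⟩ := heA
      rcases hfe x hx with hf | hf
      · exact hfresh _ hf ⟨_, he.1, Sym2.mem_mk_left _ _⟩
      · exact hfresh _ hf ⟨_, he.1, Sym2.mem_mk_right _ _⟩
    rw [hS, Finset.union_sdiff_cancel_right hAE, Finset.sdiff_union_of_subset]
    exact Finset.insert_subset_iff.2 ⟨h1, Finset.singleton_subset_iff.2 h2⟩

/-! ## Case `B2b` -/

/-- **Madras' modification, case `B2b`.** For a polygon `E` of `ℤ²` in case `B2b` at the window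
`Y` with vertex-free right corridor, `modify E Y` is a polygon with `#E + 8` edges containing the
output vertical 2-segment in column `Y 0 + 3`; window bound, vertex bookkeeping, survival of every
vertex except the dropped corner `Y + (0, 2)`, and the explicit inverse.
[cite: Hammond2015SAPJoining, §4.1 (Figure: Madras' cases)] -/
theorem modify_spec_B2b : ∀ (E : Finset (Sym2 (Site 2))) (Y : Site 2), IsPolygon (zdGraph 2) E → caseOf E Y = JCase.B2b → (∀ s t : ℤ, 1 ≤ s → -1 ≤ t → t ≤ 1 → ¬ IsV E (Y + ![s, t])) → IsPolygon (zdGraph 2) (modify E Y) ∧ (modify E Y).card = E.card + 8 ∧ s(pt Y (3, -1), pt Y (3, 0)) ∈ modify E Y ∧ s(pt Y (3, 0), pt Y (3, 1)) ∈ modify E Y ∧ (∀ p : Site 2, IsV (modify E Y) p → -1 ≤ p 1 - Y 1 → p 1 - Y 1 ≤ 1 → p 0 ≤ Y 0 + 3) ∧ (∀ p : Site 2, IsV (modify E Y) p → IsV E p ∨ p ∈ newCells JCase.B2b Y) ∧ (∀ p : Site 2, IsV E p → p ≠ pt Y (0, 2) → IsV (modify E Y) p) ∧ unmodify JCase.B2b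 (modify E Y) Y = E := by
  intro E Y hE hc hcorr
  -- the case facts: `Y` is not a vertex, `q = Y + e₁` and `c' = Y + (1,2)` are, `c'c'+e₀ ∉ E`
  obtain ⟨hY, hq, hc', hr⟩ : ¬ IsV E Y ∧ IsV E (Y + e₁) ∧ IsV E (pt Y (1, 2)) ∧
      s(pt Y (1, 2), pt Y (2, 2)) ∉ E := by
    have hc₀ := hc; unfold caseOf at hc₀; split_ifs at hc₀; exact ⟨‹_›, ‹_›, ‹_›, ‹_›⟩
  rw [add_e₁_eq] at hq
  -- `q`: right neighbour `(1,1)` in the corridor, lower neighbour `Y` not a vertex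
  obtain ⟨-, h1⟩ := corner_edges hE Y 0 1 1 (Or.inl rfl) hq
    (by norm_num; exact notMem_of_not_isV (hcorr 1 1 (by norm_num) (by norm_num) (by norm_num)))
    (by norm_num; rw [pt_zero]; exact notMem_of_not_isV hY)
  -- `c'`: right edge absent, lower neighbour `(1,1)` in the corridor
  obtain ⟨h2, -⟩ := corner_edges hE Y 1 2 1 (Or.inl rfl) hc' (by norm_num; exact hr)
    (by norm_num; exact notMem_of_not_isV (hcorr 1 1 (by norm_num) (by norm_num) (by norm_num)))
  norm_num at h1 h2
  rw [Sym2.eq_swap] at h2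
  have hR : removedE JCase.B2b Y = {s(pt Y (0, 1), pt Y (0, 2)), s(pt Y (0, 2), pt Y (1, 2))} := by
    simp [removedE, remPairs]
  obtain ⟨hP, hcard, hwin, hnew, hsurv, hunm, hAS⟩ := surgery hE Y (p := (0, 1)) (m := (0, 2))
    (q := (1, 2)) (l := [(0, 0), (1, 0), (1, -1), (2, -1), (3, -1), (3, 0), (3, 1), (2, 1), (1, 1),
      (1, 2)]) (by decide) (by decide) (by decide) (by decide) (by decide) (by decide) (by decide)
    (by decide) (by decide) hY hcorr h1 h2 (addedE JCase.B2b Y) (modify E Y) rfl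
    (by rw [modify, hc, hR])
  refine ⟨hP, ?_, hAS ?_, hAS ?_, hwin, hnew, hsurv, ?_⟩
  · simp only [List.length_cons, List.length_nil] at hcard
    omega
  · rw [addedE, List.mem_toFinset, List.mem_map]
    exact ⟨((3, -1), (3, 0)), by decide, rfl⟩
  · rw [addedE, List.mem_toFinset, List.mem_map]
    exact ⟨((3, 0), (3, 1)), by decide, rfl⟩
  · rw [unmodify, hR]
    exact hunm

/-! ## Case `C2b` -/

/-- **Madras' modification, case `C2b`** (mirror image of `B2b` in the row of `Y`). For a polygon
`E` of `ℤ²` in case `C2b` at the window `Y`, with `Y - e₁` a vertex and vertex-free right corridor,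
`modify E Y` is a polygon with `#E + 8` edges containing the output vertical 2-segment in column
`Y 0 + 3`; window bound, vertex bookkeeping, survival of every vertex except the dropped corner
`Y - (0, 2)`, and the explicit inverse. [cite: Hammond2015SAPJoining, §4.1 (Figure: Madras' cases)] -/
theorem modify_spec_C2b : ∀ (E : Finset (Sym2 (Site 2))) (Y : Site 2), IsPolygon (zdGraph 2) E → caseOf E Y = JCase.C2b → IsV E (Y - e₁) → (∀ s t : ℤ, 1 ≤ s → -1 ≤ t → t ≤ 1 → ¬ IsV E (Y + ![s, t])) → IsPolygon (zdGraph 2) (modify E Y) ∧ (modify E Y).card = E.card + 8 ∧ s(pt Y (3, -1), pt Y (3, 0)) ∈ modify E Y ∧ s(pt Y (3, 0), pt Y (3, 1)) ∈ modify E Y ∧ (∀ p : Site 2, IsV (modify E Y) p → -1 ≤ p 1 - Y 1 → p 1 - Y 1 ≤ 1 → p 0 ≤ Y 0 + 3) ∧ (∀ p : Site 2, IsV (modify E Y) p → IsV E p ∨ p ∈ newCells JCase.C2b Y) ∧ (∀ p : Site 2, IsV E p → p ≠ pt Y (0, -2) → IsV (modify E Y) p) ∧ unmodify JCase.C2b (modify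 E Y) Y = E := by
  intro E Y hE hc hb hcorr
  -- the case facts: `Y` is not a vertex, `d' = Y + (1,-2)` is, `d'd'+e₀ ∉ E`
  obtain ⟨hY, hd', hr⟩ : ¬ IsV E Y ∧ IsV E (pt Y (1, -2)) ∧ s(pt Y (1, -2), pt Y (2, -2)) ∉ E := by
    have hc₀ := hc; unfold caseOf at hc₀; split_ifs at hc₀; exact ⟨‹_›, ‹_›, ‹_›⟩
  rw [sub_e₁_eq] at hb
  -- `b = Y - e₁`: right neighbour `(1,-1)` in the corridor, upper neighbour `Y` not a vertex
  obtain ⟨-, h1⟩ := corner_edges hE Y 0 (-1) (-1) (Or.inr rfl) hb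
    (by norm_num; exact notMem_of_not_isV (hcorr 1 (-1) (by norm_num) (by norm_num) (by norm_num)))
    (by norm_num; rw [pt_zero]; exact notMem_of_not_isV hY)
  -- `d'`: right edge absent, upper neighbour `(1,-1)` in the corridor
  obtain ⟨h2, -⟩ := corner_edges hE Y 1 (-2) (-1) (Or.inr rfl) hd' (by norm_num; exact hr)
    (by norm_num; exact notMem_of_not_isV (hcorr 1 (-1) (by norm_num) (by norm_num) (by norm_num)))
  norm_num at h1 h2
  rw [Sym2.eq_swap] at h2
  have hR : removedE JCase.C2b Y =
      {s(pt Y (0, -1), pt Y (0, -2)), s(pt Y (0, -2), pt Y (1, -2))} := by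
    rw [Sym2.eq_swap (a := pt Y (0, -1))]
    simp [removedE, remPairs]
  obtain ⟨hP, hcard, hwin, hnew, hsurv, hunm, hAS⟩ := surgery hE Y (p := (0, -1)) (m := (0, -2))
    (q := (1, -2)) (l := [(0, 0), (1, 0), (1, 1), (2, 1), (3, 1), (3, 0), (3, -1), (2, -1), (1, -1),
      (1, -2)]) (by decide) (by decide) (by decide) (by decide) (by decide) (by decide) (by decide)
    (by decide) (by decide) hY hcorr h1 h2 (addedE JCase.C2b Y) (modify E Y) rfl
    (by rw [modify, hc, hR])
  refine ⟨hP, ?_, hAS ?_, hAS ?_, hwin, hnew, hsurv, ?_⟩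
  · simp only [List.length_cons, List.length_nil] at hcard
    omega
  · rw [addedE, List.mem_toFinset, List.mem_map]
    exact ⟨((3, 0), (3, -1)), by decide, Sym2.eq_swap⟩
  · rw [addedE, List.mem_toFinset, List.mem_map]
    exact ⟨((3, 1), (3, 0)), by decide, Sym2.eq_swap⟩
  · rw [unmodify, hR]
    exact hunm

end Summit.CriticalPhenomena.SAWScalingLimit.Theorems.CriticalBubbleBound.Join

end
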